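import Literature.AlgebraicGeometry.Resolution.NormalDegreePDefectlessGalois
import Literature.AlgebraicGeometry.Resolution.ResidueTranscendentalExtensions
import Literature.AlgebraicGeometry.Resolution.NagataIntersection
import Literature.FieldTheory.ArtinSchreier.PrimeDegree
import HarnessLib

/-!
# Galois extensions of degree `p` of henselized inertially generated function fields: reduction to the residue degree (Kuhlmann 2010, Cor. 4.2 via Props. 4.12–4.13)

Topic: `Literature/AlgebraicGeometry/Resolution` (valued function fields). First layer of the
decomposition of the named fact `Kuhlmann2010GaloisDegreePDefectless` (`NormalDegreePDefectless.lean`)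
= F.-V. Kuhlmann, *Elimination of ramification I: The generalized stability theorem*, Trans. AMS
362 (2010) 5697–5727 = arXiv:1003.5678, **Cor. 4.2** ("Let `(F|K,v)` be a henselized inertially
generated function field of transcendence degree 1 and rank 1. If `(K,v)` is a defectless
field, then every Galois extension `(E|F,v)` of degree `p` is defectless") in the specialisation
in which p. 20 consumes it (`K` algebraically closed, residue-transcendental generator), along
the printed proof. Cor. 4.2 is Prop. 4.1 for a defectless `K` ("either `(E|F,v)` is defectless
or there is a Galois extension `L|K` of degree `p` with non-trivial defect …" — an algebraically
closed `K` has no Galois extension of degree `p`), and Prop. 4.1 in the residue-transcendental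
case (4.3) is proved in §4.3 by two normal forms, according to the characteristic of `K`
(p. 10: "If `char K = p`, then the Galois extension `E|F` of degree `p` is an Artin-Schreier
extension … If `char K = 0` and `K` contains all `p`-th roots of unity, then `E|F` is a Kummer
extension"):

> **Proposition 4.12.** Let `K`, `F` and `E` be as in the residue-transcendental case of
> Proposition 4.1, and assume that `char K = p`. … If `vc_ju_j < 0` for some `j ∈ I` with
> `u_j ≠ 1`, then `Ē|F̄` is purely inseparable of degree `p`. If `vc_iu_i = 0` for all `i ∈ I`,
> then `Ē|F̄` is separable of degree `p`. In both cases, `(E|F,v)` is defectless. [Third case: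
> `(L.E|L.F,v)` is defectless for `L = K(ϑ₀)`, `ϑ₀^p - ϑ₀ = c_ℓ` — here `L = K`.]
>
> **Proposition 4.13.** Let `K`, `F` and `E` be as in the residue-transcendental case of
> Proposition 4.1, and assume that `char K = 0`. … In all cases, `[Ē:F̄] = p`, with the
> extension being separable if and only if `r = 1` and `vc_i = (p/(p-1))vp` for all `i ∈ I`.

Both printed proofs END in one of two ways (p. 16: "we can infer from part b) of Lemma 4.8 that
`χ̄ ∉ F̄`. Thus, `[Ē:F̄] ≥ p`" with `χ̄^p ∈ F̄`; "If the polynomial `X^p - X - Σ c̄ᵢūᵢ` were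
reducible, then Hensel's Lemma would yield that `[E:F] < p` … Hence `[Ē:F̄] ≥ p`"; p. 17
likewise), followed by "By the fundamental inequality, equality holds". This file PROVES these
closing steps once and for all and vendors Prop. 4.12, in the form consumed, as the named fact of
the next layer. Logically this layer is a REFORMULATION of the equal-characteristic half of
Cor. 4.2 as vendored, not a strictly weaker statement: `Kuhlmann2010GaloisResidueDegreeEqChar`
and that half imply each other (`Kuhlmann2010Prop41RTEqualChar.of_residueDegree`,
`Kuhlmann2010GaloisResidueDegreeEqChar.of_galoisDefectless`), exactly as
`Kuhlmann2010Prop41RTEqualChar` already is; its point is to fix the TARGET of the next layer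
(the normal form of Prop. 4.12 ends in the two exits below).

This file sits on top of `NormalDegreePDefectlessGalois.lean` (Cor. 4.2 from Prop. 4.1 (char `p`,
`Kuhlmann2010Prop41RTEqualChar`) and Prop. 4.13 (char `0`, `Kuhlmann2010Prop413ResidueDegree`),
with `charP_or_charZero_of_residueField` and `Kuhlmann2010GaloisDegreePDefectless.of_parts`) and
refines its equal-characteristic input to the residue-degree statement of Prop. 4.12.

## Content

* `le_relfinrank_residue_of_pow_eq` — **the purely inseparable exit**: if `t ∈ N'v` has
  `t^p = w ∈ Nv` with `w ∉ (Nv)^p`, then `[N'v : Nv] ≥ p` ("`χ̄ ∉ F̄`. Thus, `[Ē:F̄] ≥ p`").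
  PROVED.
* `le_relfinrank_residue_of_pow_sub_self_eq` — **the Artin–Schreier exit**: if `t ∈ N'v` has
  `t^p - t = a ∈ Nv` with `a ∉ ℘(Nv)`, then `[N'v : Nv] ≥ p` (the residue polynomial
  `X^p - X - a` is irreducible, Lang VI Thm. 6.4 (ii), `Literature.FieldTheory.ArtinSchreier`).
  PROVED.
* `IsHenselizedInertiallyGeneratedRT.relIndex_valueSubgroup_eq_one` — for `N` in the class
  over an algebraically closed `K` and `N ≤ N'` finite: `(vN' : vN) = 1` (`vN' = vN = vK`,
  divisible, §2.5 and Lemma 2.1). PROVED. (The closing step "By the fundamental inequality,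
  equality holds" is `isDefectlessExtension_of_relfinrank_residueSubfield_eq` of
  `NormalDegreePDefectlessGalois.lean`.)
* NAMED FACT `Kuhlmann2010GaloisResidueDegreeEqChar` (Prop. 4.12, as consumed: `char K = p` ⇒
  `[N'v : Nv] = p`; the mixed-characteristic counterpart, Prop. 4.13, is
  `Kuhlmann2010Prop413ResidueDegree` of `NormalDegreePDefectlessGalois.lean`).
* `Kuhlmann2010Prop41RTEqualChar.of_residueDegree` — Prop. 4.1 (residue-transcendental case,
  char `p`, as vendored) from Prop. 4.12; `Kuhlmann2010GaloisDegreePDefectless.of_residueDegree` —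
  **Cor. 4.2 (as vendored) from Prop. 4.12 and Prop. 4.13**; and the converse
  `Kuhlmann2010GaloisResidueDegreeEqChar.of_galoisDefectless`. PROVED.

## Sources

* F.-V. Kuhlmann, *Elimination of ramification I: The generalized stability theorem*, Trans.
  Amer. Math. Soc. 362 (2010) 5697–5727 = arXiv:1003.5678: §1 (1) (fundamental inequality),
  §2.1 Lemma 2.1, §2.5 ("`vF = vK` is divisible … in the residue-transcendental case"), §4
  (standing hypothesis (4.1), cases (4.2)/(4.3), (4.4)–(4.7), Prop. 4.1, Cor. 4.2), §4.2
  (Lemmas 4.7–4.11), §4.3 (Props. 4.12, 4.13 and their proofs, pp. 15–17 of the arXiv version),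
  §5 p. 20.
* S. Lang, *Algebra*, GTM 211, Ch. VI §6, Thm. 6.4 (Artin–Schreier).

## Rendering notes

* Ambient rendering as in `HenselizedFunctionFields.lean` / `NormalDegreePDefectless.lean`: one
  algebraically closed valued field `(Ω, V)` with `char Ωv = p > 0`; `[N'v : Nv]` is
  `(residueSubfield N V).relfinrank (residueSubfield N' V)` and `(vN' : vN)` is
  `(valueSubgroup N V).relIndex (valueSubgroup N' V)` (these are `f` and `e` of `V ∩ N'` over
  `N`, `DefectAmbient.lean`).
* "`char K = p`" / "`char K = 0`" is `CharP Ω p` / `CharZero Ω` (`K ≤ N ≤ N' ≤ Ω` have the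
  characteristic of `Ω`).
* The named fact keeps the printed conclusion "of degree `p`" of Prop. 4.12 (as
  `Kuhlmann2010Prop413ResidueDegree` keeps "In all cases, `[Ē:F̄] = p`" of Prop. 4.13), its third
  case being absorbed for an algebraically closed `K` (`c_ℓ ∈ K = ℘(K)`, so `L = K`, `L.E = E`,
  `L.F = F`), for the same fields as `Kuhlmann2010GaloisDegreePDefectless` (which is the case p. 20
  uses); its proof is Lemmas 4.8–4.10 with [K5] Thm. 10 (Frobenius-closed bases), Lemma 2.4 and
  the normal-form computation of pp. 15–16, the next layers of this decomposition.
-/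

noncomputable section

open IsLocalRing

namespace Literature.AlgebraicGeometry.Resolution

universe u

variable {Ω : Type u} [Field Ω] (V : ValuationSubring Ω)

/-! ### The two exits: residue extensions of degree `≥ p` -/

section Exits

variable {V}

/-- **The purely inseparable exit** (Kuhlmann 2010, proof of Prop. 4.12, p. 16: "`χ̄^p = Σ d̄ᵢūᵢ`
… we can infer from part b) of Lemma 4.8 that `χ̄ ∉ F̄`. Thus, `[Ē:F̄] ≥ p`"; proof of
Prop. 4.13, p. 17: "`ϑ̄ = r̄^{1/p} ∉ F̄`", "As in Proposition 4.12 we see that `χ̄ ∉ F̄`"): inside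
`(Ω, V)` with `char Ωv = p`, for subfields `N ≤ N'` with `[N'v : Nv]` finite, an element
`t ∈ N'v` with `t^p = w ∈ Nv` and `w` not a `p`-th power in `Nv` generates `Nv(t)` of degree `p`
(minimal polynomial `X^p - w`), so `[N'v : Nv] ≥ p`. PROVED.
[cite: Kuhlmann2010, Prop. 4.12 (proof, p. 16) and Prop. 4.13 (proof, p. 17)] -/
theorem le_relfinrank_residue_of_pow_eq {p : ℕ} [Fact p.Prime] [CharP (ResidueField V) p]
    {N N' : Subfield Ω} (hNN' : N ≤ N')
    (hfin : 0 < (residueSubfield N V).relfinrank (residueSubfield N' V))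
    {t : ResidueField V} (ht : t ∈ residueSubfield N' V) {w : ResidueField V}
    (hw : w ∈ residueSubfield N V) (htw : t ^ p = w)
    (hnot : ∀ s ∈ residueSubfield N V, s ^ p ≠ w) :
    p ≤ (residueSubfield N V).relfinrank (residueSubfield N' V) := by
  have hAB : residueSubfield N V ≤ residueSubfield N' V := residueSubfield_subfield_mono hNN'
  rw [Subfield.relfinrank_eq_finrank_of_le hAB] at hfin ⊢
  haveI : FiniteDimensional (residueSubfield N V) (Subfield.extendScalars hAB) :=
    Module.finite_of_finrank_pos hfin
  have hnotin : t ∉ (algebraMap (residueSubfield N V) (ResidueField V)).range := by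
    rintro ⟨s, hs⟩
    exact hnot s s.2 (by rw [← htw, ← hs]; rfl)
  have hdeg : Module.finrank (residueSubfield N V)
      (IntermediateField.adjoin (residueSubfield N V) ({t} : Set (ResidueField V))) = p :=
    finrank_adjoin_simple_eq_of_not_mem_range p (F := residueSubfield N V) (c := ⟨w, hw⟩)
      htw.symm hnotin
  have hadj : IntermediateField.adjoin (residueSubfield N V) ({t} : Set (ResidueField V)) ≤
      Subfield.extendScalars hAB :=
    IntermediateField.adjoin_simple_le_iff.mpr ((Subfield.mem_extendScalars (h := hAB)).mpr ht)
  rw [← hdeg]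
  exact IntermediateField.finrank_le_of_le_right hadj

/-- **The Artin–Schreier exit** (Kuhlmann 2010, proof of Prop. 4.12, p. 16: "`ϑ̄^p - ϑ̄ = Σ c̄ᵢūᵢ`.
If the polynomial `X^p - X - Σ c̄ᵢūᵢ` were reducible, then Hensel's Lemma would yield that
`[E:F] < p` in contradiction to our assumption. Hence `[Ē:F̄] ≥ p`"; proof of Prop. 4.13, p. 17:
"the residue polynomial `Z^p - Z - (bC^{-p})‾` does not admit a zero in `F̄` … `[Ē:F̄] ≥ p`"):
inside `(Ω, V)` with `char Ωv = p`, for subfields `N ≤ N'` with `[N'v : Nv]` finite, an element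
`t ∈ N'v` with `t^p - t = a ∈ Nv` and `a ∉ ℘(Nv) = {s^p - s}` has degree `p` over `Nv` (Lang VI
Thm. 6.4 (ii): `X^p - X - a` is then irreducible; `Literature.FieldTheory.ArtinSchreier`), so
`[N'v : Nv] ≥ p`. PROVED. [cite: Kuhlmann2010, Prop. 4.12 (proof, p. 16) and Prop. 4.13 (proof, p. 17)] -/
theorem le_relfinrank_residue_of_pow_sub_self_eq {p : ℕ} [Fact p.Prime] [CharP (ResidueField V) p]
    {N N' : Subfield Ω} (hNN' : N ≤ N')
    (hfin : 0 < (residueSubfield N V).relfinrank (residueSubfield N' V))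
    {t : ResidueField V} (ht : t ∈ residueSubfield N' V) {a : ResidueField V}
    (ha : a ∈ residueSubfield N V) (hta : t ^ p - t = a)
    (hnot : ∀ s ∈ residueSubfield N V, s ^ p - s ≠ a) :
    p ≤ (residueSubfield N V).relfinrank (residueSubfield N' V) := by
  have hAB : residueSubfield N V ≤ residueSubfield N' V := residueSubfield_subfield_mono hNN'
  rw [Subfield.relfinrank_eq_finrank_of_le hAB] at hfin ⊢
  haveI : FiniteDimensional (residueSubfield N V) (Subfield.extendScalars hAB) :=
    Module.finite_of_finrank_pos hfin
  haveI : CharP (residueSubfield N V) p :=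
    (algebraMap (residueSubfield N V) (ResidueField V)).charP
      (algebraMap (residueSubfield N V) (ResidueField V)).injective p
  have hc : ∀ s : residueSubfield N V, s ^ p - s ≠ ⟨a, ha⟩ := by
    intro s hs
    exact hnot s s.2 (by have h := congrArg Subtype.val hs; simpa using h)
  have hdeg : Module.finrank (residueSubfield N V)
      (IntermediateField.adjoin (residueSubfield N V) ({t} : Set (ResidueField V))) = p :=
    Literature.FieldTheory.ArtinSchreier.finrank_adjoin_simple_eq p (F := residueSubfield N V)
      (c := ⟨a, ha⟩) hta hc
  have hadj : IntermediateField.adjoin (residueSubfield N V) ({t} : Set (ResidueField V)) ≤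
      Subfield.extendScalars hAB :=
    IntermediateField.adjoin_simple_le_iff.mpr ((Subfield.mem_extendScalars (h := hAB)).mpr ht)
  rw [← hdeg]
  exact IntermediateField.finrank_le_of_le_right hadj

end Exits

/-! ### `vN' = vN` -/

section ValueGroup

variable {V}

/-- **`(vN' : vN) = 1` for a finite extension `N'` of a field `N` of the class over an
algebraically closed `K`** (§2.5: "`vF = vK` is divisible … in the residue-transcendental case";
Lemma 2.1: `vN'/vN` is torsion, so `vN' = vN`; `ResidueTranscendentalExtensions.lean`). PROVED.
[cite: Kuhlmann2010, Section 2.5 and Lemma 2.1] -/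
theorem IsHenselizedInertiallyGeneratedRT.relIndex_valueSubgroup_eq_one [IsAlgClosed Ω]
    {K N N' : Subfield Ω} (hK : IsAlgClosed K) (hN : IsHenselizedInertiallyGeneratedRT V K N)
    (hNN' : N ≤ N') (hpos : 0 < Subfield.relfinrank N N') :
    (valueSubgroup N V).relIndex (valueSubgroup N' V) = 1 := by
  rw [hN.valueSubgroup_eq, hN.valueSubgroup_eq_of_algebraic hK hNN'
    (fun a ha => isAlgebraic_of_relfinrank_pos hNN' hpos ha), Subgroup.relIndex_self]

end ValueGroup

/-! ### Prop. 4.12 in the form consumed (named fact) -/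

/-- NAMED FACT — **Kuhlmann 2010, Prop. 4.12 (equal characteristic: Artin–Schreier extensions of
degree `p` have residue degree `p`), in the form consumed on p. 20.** Printed statement: "Let `K`,
`F` and `E` be as in the residue-transcendental case of Proposition 4.1, and assume that
`char K = p`. Choose a ring `R` with Frobenius-closed basis `ℬ` in `F|K` as in Lemma 4.10. Then
either `E = F(ϑ)` where `ϑ^p - ϑ ∈ K`, or `E = F(ϑ)` where `ϑ^p - ϑ = Σ_{i∈I} cᵢuᵢ`,
`0 ≠ cᵢ ∈ K`, `uᵢ ∈ ℬ` with `I` a finite index set, and such that no element `uᵢ ≠ 1` is a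
`p`-th power in `ℬ`, and `∀ i ∈ I: vcᵢuᵢ = vcᵢ ≤ 0`. If `vc_ju_j < 0` for some `j ∈ I` with
`u_j ≠ 1`, then `Ē|F̄` is purely inseparable of degree `p`. If `vcᵢuᵢ = 0` for all `i ∈ I`,
then `Ē|F̄` is separable of degree `p`. In both cases, `(E|F,v)` is defectless. Suppose that
`u_ℓ = 1` for some `ℓ ∈ I` and `c_ℓu_ℓ` is the only summand of value `< 0`. Take `L` to be the
Galois extension of `K` generated by a root of the polynomial `X^p - X - c_ℓ`. If `I = {ℓ}` then
(4.16) holds and the extension `(L.E|L.F,v)` is trivial. Otherwise, `(L.E)‾|(L.F)‾` is separable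
of degree `p`. In both cases, `(L.E|L.F,v)` is defectless and if `(E|F,v)` has non-trivial
defect, then `(L|K,v)` has non-trivial defect." Here `K` is algebraically closed (the case of
p. 20, which satisfies the standing hypothesis (4.1): henselian, `char K̄ = p`, closed under
`p`-th roots), so `K = ℘(K)`: the first alternative `ϑ^p - ϑ ∈ K` cannot occur for `[E:F] = p`,
and in the last case `L = K`, `L.E = E`, `L.F = F`; in every case the printed conclusion is
`[Ē : F̄] = p`. Rendering: `(Ω, V)` algebraically closed with `char Ω = char Ωv = p`, `K ≤ Ω` an
algebraically closed subfield, `N` in the class `IsHenselizedInertiallyGeneratedRT V K` (the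
residue-transcendental case (4.3), §2.5 (2.7)), `N ≤ N'` Galois of degree `p` (`IsGaloisStep`;
an Artin–Schreier extension by (4.4), `Literature.FieldTheory.ArtinSchreier`); then
`[N'v : Nv] = p`. Its proof is pp. 13–16 of the source: Lemma 4.10 (an embedding of `F̄` in `F`
over the residue map, `R = K[F̄]` with a lifted Frobenius-closed basis, [K5] Thm. 10), Lemma 4.9
(`F = R + ℘(F)`, with Lemma 2.4), Lemma 4.8, Hensel's Lemma and the two exits above. Users take
`(h : Kuhlmann2010GaloisResidueDegreeEqChar)`.
[cite: Kuhlmann2010, Prop. 4.12 (with Lemmas 4.8–4.10 and Section 5, p. 20)] -/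
def Kuhlmann2010GaloisResidueDegreeEqChar : Prop :=
  ∀ (Ω : Type u) [Field Ω] [IsAlgClosed Ω] (V : ValuationSubring Ω) (p : ℕ) [CharP (ResidueField V) p]
    [CharP Ω p], p.Prime → ∀ (K N N' : Subfield Ω), IsAlgClosed K →
    IsHenselizedInertiallyGeneratedRT V K N → IsGaloisStep p N N' →
    (residueSubfield N V).relfinrank (residueSubfield N' V) = p

/-! ### Assembly: Prop. 4.1 and Cor. 4.2 from Props. 4.12 and 4.13 -/

/-- **Prop. 4.1 (residue-transcendental case, equal characteristic, as vendored in
`Kuhlmann2010Prop41RTEqualChar`) from Prop. 4.12** (§4.3: "Using Lemma 4.10, we derive the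
following normal form, which proves the equal characteristic residue-transcendental case of
Proposition 4.1"): the residue extension has degree `p = [N' : N]`
(`Kuhlmann2010GaloisResidueDegreeEqChar`), so "By the fundamental inequality, equality holds"
(`isDefectlessExtension_of_relfinrank_residueSubfield_eq`): `(N'|N,v)` is defectless — the first
alternative of Prop. 4.1. PROVED. [cite: Kuhlmann2010, Prop. 4.1 and Prop. 4.12] -/
theorem Kuhlmann2010Prop41RTEqualChar.of_residueDegree
    (hE : Kuhlmann2010GaloisResidueDegreeEqChar.{u}) : Kuhlmann2010Prop41RTEqualChar.{u} := by
  intro Ω _ _ V p _ _ hp K N N' hK hN hstep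
  left
  obtain ⟨hNN', hdeg, -⟩ := id hstep
  have hrel : Subfield.relfinrank N N' = p := by
    rw [Subfield.relfinrank_eq_finrank_of_le hNN', hdeg]
  have hpos : 0 < Subfield.relfinrank N N' := by
    rw [hrel]
    exact hp.pos
  have hf : (residueSubfield N V).relfinrank (residueSubfield N' V) = p :=
    hE Ω V p hp K N N' hK hN hstep
  exact isDefectlessExtension_of_relfinrank_residueSubfield_eq hNN' hpos (hf.trans hrel.symm)

/-- **The converse: Prop. 4.12 (as vendored) from Cor. 4.2 (as vendored).** For a Galois step
`N ≤ N'` of degree `p` over a field of the class, defectlessness reads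
`p = (vN' : vN)·[N'v : Nv]` with `(vN' : vN) = 1` (`relIndex_valueSubgroup_eq_one`), i.e.
`[N'v : Nv] = p`. Hence this layer is logically equivalent to the equal-characteristic half of
`Kuhlmann2010GaloisDegreePDefectless` (a reformulation fixing the target of the next layer).
PROVED. [cite: Kuhlmann2010, Cor. 4.2 and Prop. 4.12] -/
theorem Kuhlmann2010GaloisResidueDegreeEqChar.of_galoisDefectless
    (hG : Kuhlmann2010GaloisDegreePDefectless.{u}) : Kuhlmann2010GaloisResidueDegreeEqChar.{u} := by
  intro Ω _ _ V p _ _ hp K N N' hK hN hstep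
  obtain ⟨hNN', hdeg, -⟩ := id hstep
  have hrel : Subfield.relfinrank N N' = p := by
    rw [Subfield.relfinrank_eq_finrank_of_le hNN', hdeg]
  have hpos : 0 < Subfield.relfinrank N N' := by
    rw [hrel]
    exact hp.pos
  obtain ⟨-, -, heq⟩ := hG Ω V p hp K N N' hK hN hstep
  rw [hN.relIndex_valueSubgroup_eq_one hK hNN' hpos, one_mul, hrel] at heq
  exact heq.symm

/-- **Kuhlmann 2010, Cor. 4.2 in the form of `Kuhlmann2010GaloisDegreePDefectless`, from
Prop. 4.12 and Prop. 4.13** (p. 10: "If `char K = p`, then the Galois extension `E|F` of degree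
`p` is an Artin-Schreier extension … If `char K = 0` … then `E|F` is a Kummer extension"; §4.3:
"the following normal form … proves the equal characteristic [resp. mixed characteristic]
residue-transcendental case of Proposition 4.1"): `Kuhlmann2010GaloisDegreePDefectless.of_parts`
(`NormalDegreePDefectlessGalois.lean`) with Prop. 4.1 (char `p`) obtained from Prop. 4.12
(`Kuhlmann2010Prop41RTEqualChar.of_residueDegree`) and Prop. 4.13
(`Kuhlmann2010Prop413ResidueDegree`). PROVED.
[cite: Kuhlmann2010, Cor. 4.2 (with Prop. 4.1, Props. 4.12–4.13)] -/
theorem Kuhlmann2010GaloisDegreePDefectless.of_residueDegree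
    (hE : Kuhlmann2010GaloisResidueDegreeEqChar.{u})
    (hM : Kuhlmann2010Prop413ResidueDegree.{u}) :
    Kuhlmann2010GaloisDegreePDefectless.{u} :=
  Kuhlmann2010GaloisDegreePDefectless.of_parts (Kuhlmann2010Prop41RTEqualChar.of_residueDegree hE) hM

end Literature.AlgebraicGeometry.Resolution
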